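import Literature.ComputerArithmetic.LangeRump2018.Ufp

/-!
# Lange–Rump 2019, Proposition 3 PROVED: height `h`, `(h+1)²·v ≤ 1` ⟹ `|ŝ - s| ≤ h·v·Σ|xᵢ|` (`v = u` nearest, `v = 2u` faithful)

HONEST FRAMING (venture CertifiedArithmetic / cell `pub-lowprec`): certified error envelopes and
provably optimal rounding/accumulation schemes for low-precision formats under stated cost models;
every table by two implementations; no hardware or vendor claims.

[LangeRump2018, Prop 3] (M. Lange, S. M. Rump, *Sharp estimates for perturbation errors in
summations*, Math. Comp. 88 (2019), radix `β = 2`; quoted as [BoldoEtAl2023, Thm 4.4]): let `s`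
be the result of a floating-point summation of `a₁, …, aₙ ∈ F` in some nearest-addition in any
order; if the height `h` of the binary summation tree satisfies `h ≤ u^{-1/2} - 1` then
`|s - Σ aⱼ| ≤ h·u·Σ|aⱼ|`; and "if one substitutes `2u` for `u` in the restriction as well as in the
bound, the result remains valid for any faithful-addition". PROVED here over the number system of
`JeannerodRump2018/Summation.lean` (precision `p ≥ 1`, gradual underflow, no overflow), with the
restriction written `(h+1)²·v ≤ 1`: `proposition3` (any round-to-nearest map, `v = u`) and
`proposition3_faithful` (any faithful map into `F`: every float between `t` and `fl t` equals
`fl t`; `v = 2u`), both from ONE induction `height_induction_with` for an arbitrary map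
`fl` landing in `F` whose additions err by `≤ c·ufp(argument)`.

THE PROOF is the paper's: Theorem 7 (perturbed trees) specialised to binary trees and radix 2
(`c_h = β⁻¹ - β⁻² = ¼`, `ε = b = c`), induction on the height with the strengthened hypothesis (25)
`Σ|δ| ≤ h·c·T - (η - h)·max(b_r - c·T, 0)` (`T = Σ|aⱼ|`, any `η` with `(η+1)²c ≤ 1`, `b_r = c·ufp`
at the root), cases `b_r ≤ cT` / `b_r ≤ b_p + b_q` / else (discreteness (27): `b_p + b_q ≤ ¾ b_r`;
two-level bound; (28); AM–GM). ONE DEVIATION: the paper's proof of Prop 3 takes `b_j = η·ufp(s_j)`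
with `s_j` the COMPUTED node value and asserts `b_j ≤ η·|s_j - δ_j|` for (22), which fails when
`s_j` is a power of two reached by rounding up (`½ + (½ - u/2) ↦ 1` under ties-to-even); we take
`b_j = c·ufp(y_j)` for the node's exact ARGUMENT `y_j = s_j - δ_j` (`Ufp.lean`), for which
`|δ_j| ≤ b_j ≤ c|y_j| ≤ c(T_j + Σ_{below}|δ|)` holds, and Theorem 7 applies verbatim. Corollary 4 (dot products,
barring underflow) is the same induction with product cells (`absErr_le_height_with` +
`localErr_of_no_underflow`). Not here: Remark 8 (`hu/(1+u)`), Lemma 9 (necessity).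
-/

namespace Literature.ComputerArithmetic.LangeRump2018

open Literature.ComputerArithmetic.JeannerodRump2018
open Literature.ComputerArithmetic.JeannerodRump2018.SumTree

variable {p : ℕ} {emin : ℤ} {fl : ℚ → ℚ}

/-- Height of an evaluation tree (leaf `0`). [cite: LangeRump2018, §4] -/
def height : SumTree → ℕ
  | .leaf _ => 0
  | .node l r => max (height l) (height r) + 1

/-- `ufp 0 = 0`. [cite: LangeRump2018, §4 ("ufp(0) := 0")] -/
theorem ufp_zero (p : ℕ) (emin : ℤ) : ufp p emin 0 = 0 := by
  unfold ufp; rw [if_pos]; rw [abs_zero]; exact zpow_pos (by norm_num) _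

/-- [LangeRump2018, (27)] in radix 2 for two children: floors summing below the parent's floor sum
to at most `¾` of it. [cite: LangeRump2018, (27)] -/
theorem ufp_add_ufp_le_of_lt {a b c : ℚ} (hlt : ufp p emin a + ufp p emin b < ufp p emin c) :
    ufp p emin a + ufp p emin b ≤ 3 / 4 * ufp p emin c := by
  have ha := ufp_nonneg p emin a
  have hb := ufp_nonneg p emin b
  rcases le_total (ufp p emin a) (ufp p emin b) with hab | hab
  · have h2 := two_mul_ufp_le_of_lt (lt_of_le_of_lt (by linarith) hlt : ufp p emin b < ufp p emin c)
    rcases lt_or_eq_of_le h2 with hlt2 | heq2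
    · have := four_mul_ufp_le_of_lt hlt2; linarith
    · have hlt3 : ufp p emin a < ufp p emin b := by linarith
      have := two_mul_ufp_le_of_lt hlt3; linarith
  · have h2 := two_mul_ufp_le_of_lt (lt_of_le_of_lt (by linarith) hlt : ufp p emin a < ufp p emin c)
    rcases lt_or_eq_of_le h2 with hlt2 | heq2
    · have := four_mul_ufp_le_of_lt hlt2; linarith
    · have hlt3 : ufp p emin b < ufp p emin a := by linarith
      have := two_mul_ufp_le_of_lt hlt3; linarith

/-- The root's exact argument (`0` for a leaf). [cite: LangeRump2018, Thm 7] -/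
def rootArg (fl : ℚ → ℚ) : SumTree → ℚ
  | .leaf _ => 0
  | .node l r => eval fl l + eval fl r

/-- With a map landing in `F`, every evaluated subtree is a float. [cite: LangeRump2018, §4] -/
theorem isFloat_eval_of (hval : ∀ t : ℚ, IsFloat p emin (fl t)) :
    ∀ t : SumTree, (∀ x ∈ t.leaves, IsFloat p emin x) → IsFloat p emin (eval fl t)
  | .leaf x, h => by simpa [eval, leaves] using h
  | .node _ _, _ => hval _

/-- The per-node hypothesis of Theorem 7 with `b_j = c·ufp(argument)`: every internal node's
argument `y` has `|fl y - y| ≤ c·ufp(y)` ((22) then holds since `ufp(y) ≤ |y|`).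
[cite: LangeRump2018, Thm 7 ((21)–(22))] -/
theorem allNodes_children {c : ℚ} {l r : SumTree}
    (h : AllNodes fl (fun y => |fl y - y| ≤ c * ufp p emin y) (.node l r)) :
    AllNodes fl (fun y => |fl y - y| ≤ c * ufp p emin y) l ∧
      AllNodes fl (fun y => |fl y - y| ≤ c * ufp p emin y) r ∧
      |fl (eval fl l + eval fl r) - (eval fl l + eval fl r)| ≤ c * ufp p emin (eval fl l + eval fl r) :=
  h

/-- TWO-LEVEL BOUND (local constant `c`): if every proper subtree `s` (height `+1 ≤` height of
`t`) obeys `Σ|δ| ≤ H·c·Σ|x|`, then `Σ|δ|(t) ≤ c·ufp(root arg) + H·c·Σ|x|`.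
[cite: LangeRump2018, Thm 7 (proof, case (26))] -/
theorem absErr_le_root_add_with {c : ℚ} (hc : 0 ≤ c) {H : ℚ} (hH : 0 ≤ H) :
    ∀ t : SumTree, AllNodes fl (fun y => |fl y - y| ≤ c * ufp p emin y) t →
      (∀ s : SumTree, AllNodes fl (fun y => |fl y - y| ≤ c * ufp p emin y) s →
          height s + 1 ≤ height t → absErr fl s ≤ H * c * absSum s) →
      absErr fl t ≤ c * ufp p emin (rootArg fl t) + H * c * absSum t
  | .leaf x, _, _ => by
      simp only [absErr, SumTree.localErrors, List.map_nil, List.sum_nil, rootArg, ufp_zero,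
        mul_zero, zero_add, absSum, SumTree.leaves, List.map_cons, List.sum_cons, add_zero]
      exact mul_nonneg (mul_nonneg hH hc) (abs_nonneg x)
  | .node l r, hloc, hsub => by
      obtain ⟨hl, hr, he⟩ := allNodes_children hloc
      have cl := hsub l hl (by simp only [height]; omega)
      have cr := hsub r hr (by simp only [height]; omega)
      rw [absErr_node, absSum_node]
      change absErr fl l + absErr fl r + |fl (eval fl l + eval fl r) - (eval fl l + eval fl r)| ≤ _
      simp only [rootArg]
      linarith

/-- THE HEIGHT INDUCTION, hypothesis (25) of [LangeRump2018, Thm 7] (binary trees, radix 2,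
`c_h = ¼`, `ε = b = c`, `b_j = c·ufp(argument)`), for an arbitrary map `fl` into `F` whose additions
of floats err by `≤ c·ufp(argument)`: for every `η` with `(η+1)²c ≤ 1`, every `H ≤ η` and every
tree with leaves in `F` and height `≤ H`:
`Σ|δ| ≤ H·c·Σ|xᵢ| - (η - H)·max(c·ufp(root arg) - c·Σ|xᵢ|, 0)`. [cite: LangeRump2018, Thm 7] -/
theorem height_induction_with {c : ℚ} (hc : 0 < c) {η : ℚ} (hη : (η + 1) ^ 2 * c ≤ 1) :
    ∀ H : ℕ, ∀ t : SumTree, AllNodes fl (fun y => |fl y - y| ≤ c * ufp p emin y) t →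
      height t ≤ H → (H : ℚ) ≤ η →
      absErr fl t ≤ (H : ℚ) * c * absSum t
        - (η - H) * max (c * ufp p emin (rootArg fl t) - c * absSum t) 0 := by
  intro H
  induction H using Nat.strong_induction_on with
  | _ H ih =>
    intro t ht hH hHη
    cases t with
    | leaf x =>
        have hT : 0 ≤ absSum (.leaf x) := absSum_nonneg _
        have hmax : max (c * ufp p emin (rootArg fl (.leaf x)) - c * absSum (.leaf x)) 0 = 0 :=
          max_eq_right (by simp only [rootArg, ufp_zero, mul_zero]; nlinarith)
        rw [hmax, mul_zero, sub_zero]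
        simp only [absErr, SumTree.localErrors, List.map_nil, List.sum_nil]
        exact mul_nonneg (mul_nonneg (Nat.cast_nonneg H) hc.le) hT
    | node l r =>
        obtain ⟨hlF, hrF, hloc⟩ := allNodes_children ht
        have hH1 : 1 ≤ H := by simp [height] at hH; omega
        have hpH : height l ≤ H - 1 := by simp [height] at hH; omega
        have hqH : height r ≤ H - 1 := by simp [height] at hH; omega
        have hcast : ((H - 1 : ℕ) : ℚ) = (H : ℚ) - 1 := by rw [Nat.cast_sub hH1]; simp
        have hH1η : (((H - 1 : ℕ) : ℚ)) ≤ η := by rw [hcast]; linarith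
        have ihp := ih (H - 1) (by omega) l hlF hpH hH1η
        have ihq := ih (H - 1) (by omega) r hrF hqH hH1η
        rw [hcast] at ihp ihq
        set Dp := absErr fl l
        set Dq := absErr fl r
        set Tp := absSum l
        set Tq := absSum r
        set bp := c * ufp p emin (rootArg fl l)
        set bq := c * ufp p emin (rootArg fl r)
        have hDp := absErr_nonneg fl l
        have hDq := absErr_nonneg fl r
        have hTp := absSum_nonneg l
        have hTq := absSum_nonneg r
        have hbp : 0 ≤ bp := mul_nonneg hc.le (ufp_nonneg p emin _)
        have hbq : 0 ≤ bq := mul_nonneg hc.le (ufp_nonneg p emin _)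
        have hηH : 0 ≤ η - ((H : ℚ) - 1) := by linarith
        have wp : Dp ≤ ((H : ℚ) - 1) * c * Tp :=
          le_trans ihp (sub_le_self _ (mul_nonneg hηH (le_max_right _ _)))
        have wq : Dq ≤ ((H : ℚ) - 1) * c * Tq :=
          le_trans ihq (sub_le_self _ (mul_nonneg hηH (le_max_right _ _)))
        set y := eval fl l + eval fl r with hy_def
        set e := |fl y - y| with he_def
        set br := c * ufp p emin (rootArg fl (.node l r)) with hbr_def
        have hbr_eq : br = c * ufp p emin y := rfl
        have he_br : e ≤ br := hloc
        have hEnode : absErr fl (.node l r) = Dp + Dq + e := absErr_node _ _ _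
        have hTnode : absSum (.node l r) = Tp + Tq := absSum_node _ _
        have h28 : br - c * (Tp + Tq) ≤ c * (Dp + Dq) := by
          have h1 : ufp p emin y ≤ |y| := ufp_le_abs p emin y
          have h2 : |y| ≤ |SumTree.exact l + SumTree.exact r| + Dp + Dq := by
            have : y = (SumTree.exact l + SumTree.exact r)
                + ((eval fl l - SumTree.exact l) + (eval fl r - SumTree.exact r)) := by
              rw [hy_def]; ring
            rw [this]
            refine le_trans (abs_add_le _ _) ?_
            have h3 := abs_add_le (eval fl l - SumTree.exact l) (eval fl r - SumTree.exact r)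
            have h4 := abs_eval_sub_exact_le fl l
            have h5 := abs_eval_sub_exact_le fl r
            linarith
          have h3 : |SumTree.exact l + SumTree.exact r| ≤ Tp + Tq := by
            rw [← absSum_node]; exact abs_exact_le_absSum (.node l r)
          have h4 : ufp p emin y ≤ Tp + Tq + (Dp + Dq) := by linarith
          have h5 := mul_le_mul_of_nonneg_left h4 hc.le
          rw [hbr_eq]
          linarith
        rw [hEnode, hTnode]
        by_cases hc1 : br ≤ c * (Tp + Tq)
        · have hmax : max (br - c * (Tp + Tq)) 0 = 0 := max_eq_right (by linarith)
          rw [hmax, mul_zero, sub_zero]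
          linarith
        · have hX : 0 < br - c * (Tp + Tq) := by linarith
          have hmax : max (br - c * (Tp + Tq)) 0 = br - c * (Tp + Tq) := max_eq_left hX.le
          rw [hmax]
          by_cases hc2 : br ≤ bp + bq
          · have m1 : bp - c * Tp ≤ max (bp - c * Tp) 0 := le_max_left _ _
            have m2 : bq - c * Tq ≤ max (bq - c * Tq) 0 := le_max_left _ _
            have key : Dp + Dq ≤ ((H : ℚ) - 1) * c * (Tp + Tq)
                - (η - ((H : ℚ) - 1)) * (br - c * (Tp + Tq)) := by
              have : (η - ((H : ℚ) - 1)) * (br - c * (Tp + Tq))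
                  ≤ (η - ((H : ℚ) - 1)) * (max (bp - c * Tp) 0 + max (bq - c * Tq) 0) :=
                mul_le_mul_of_nonneg_left (by linarith) hηH
              linarith
            linarith
          · have hc2' : bp + bq < br := not_le.mp hc2
            have hDpq : br - c * (Tp + Tq) ≤ ((H : ℚ) - 1) * c * c * (Tp + Tq) := by
              have := mul_le_mul_of_nonneg_left (add_le_add wp wq) hc.le
              linarith
            have hH2 : 2 ≤ H := by
              by_contra hlt
              have hH1' : H = 1 := by omega
              subst hH1'
              simp at hDpq
              linarith
            have hcast2 : ((H - 2 : ℕ) : ℚ) = (H : ℚ) - 2 := by rw [Nat.cast_sub hH2]; simp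
            have two : ∀ s : SumTree, AllNodes fl (fun y => |fl y - y| ≤ c * ufp p emin y) s →
                height s ≤ H - 1 →
                absErr fl s ≤ c * ufp p emin (rootArg fl s) + ((H : ℚ) - 2) * c * absSum s := by
              intro s hs hsh
              refine absErr_le_root_add_with hc.le (by linarith) s hs (fun s' hs' hh' => ?_)
              have := ih (H - 2) (by omega) s' hs' (by omega) (by rw [hcast2]; linarith)
              rw [hcast2] at this
              exact le_trans this (sub_le_self _ (mul_nonneg (by linarith) (le_max_right _ _)))
            have tp := two l hlF hpH
            have tq := two r hrF hqH
            have h27 : bp + bq ≤ 3 / 4 * br := by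
              have hlt : ufp p emin (rootArg fl l) + ufp p emin (rootArg fl r) < ufp p emin y := by
                have h' : c * (ufp p emin (rootArg fl l) + ufp p emin (rootArg fl r))
                    < c * ufp p emin y := by
                  rw [mul_add]; exact hc2'
                exact lt_of_mul_lt_mul_left h' hc.le
              have := mul_le_mul_of_nonneg_left (ufp_add_ufp_le_of_lt hlt) hc.le
              rw [hbr_eq]
              change c * ufp p emin (rootArg fl l) + c * ufp p emin (rootArg fl r) ≤ _
              linarith
            have amgm : (η - H + 2) * ((H : ℚ) - 1) * c ≤ 1 / 4 := by
              have h0 : (η + 1) ^ 2 / 4 - (η - H + 2) * ((H : ℚ) - 1)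
                  = ((η - H + 2) - ((H : ℚ) - 1)) ^ 2 / 4 := by ring
              have h1 : (η - H + 2) * ((H : ℚ) - 1) ≤ (η + 1) ^ 2 / 4 := by
                have := sq_nonneg ((η - H + 2) - ((H : ℚ) - 1))
                linarith
              calc (η - H + 2) * ((H : ℚ) - 1) * c ≤ (η + 1) ^ 2 / 4 * c :=
                    mul_le_mul_of_nonneg_right h1 hc.le
                _ ≤ 1 / 4 := by linarith
            have hT0 : 0 ≤ Tp + Tq := add_nonneg hTp hTq
            have hfin : (7 / 4 + η - H) * (br - c * (Tp + Tq)) ≤ c * (Tp + Tq) / 4 := by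
              have hcη : 0 ≤ 7 / 4 + η - (H : ℚ) := by linarith
              have hH1' : (1 : ℚ) ≤ H := by exact_mod_cast hH1
              have hHc : (0 : ℚ) ≤ ((H : ℚ) - 1) * c := mul_nonneg (by linarith) hc.le
              calc (7 / 4 + η - H) * (br - c * (Tp + Tq))
                  ≤ (7 / 4 + η - H) * (((H : ℚ) - 1) * c * c * (Tp + Tq)) :=
                    mul_le_mul_of_nonneg_left hDpq hcη
                _ = ((η - H + 7 / 4) * (((H : ℚ) - 1) * c)) * (c * (Tp + Tq)) := by ring
                _ ≤ ((η - H + 2) * (((H : ℚ) - 1) * c)) * (c * (Tp + Tq)) := by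
                    apply mul_le_mul_of_nonneg_right _ (mul_nonneg hc.le hT0)
                    exact mul_le_mul_of_nonneg_right (by linarith) hHc
                _ ≤ (1 / 4) * (c * (Tp + Tq)) := by
                    apply mul_le_mul_of_nonneg_right _ (mul_nonneg hc.le hT0)
                    have : (η - H + 2) * (((H : ℚ) - 1) * c) = (η - H + 2) * ((H : ℚ) - 1) * c := by
                      ring
                    rw [this]; exact amgm
                _ = c * (Tp + Tq) / 4 := by ring
            have hsum : Dp + Dq + e ≤ br + (bp + bq) + ((H : ℚ) - 2) * c * (Tp + Tq) := by
              have : Dp + Dq ≤ bp + ((H : ℚ) - 2) * c * Tp + (bq + ((H : ℚ) - 2) * c * Tq) :=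
                add_le_add tp tq
              linarith
            linarith

/-- HEIGHT BOUND UNDER THE PER-NODE HYPOTHESIS: if every internal node's argument `y` satisfies
`|fl y - y| ≤ c·ufp(y)` and the height `h` satisfies `(h+1)²·c ≤ 1`, then
`Σ_nodes |δ_v| ≤ h·c·Σ|leaves|` (leaves arbitrary rationals — this also covers [LangeRump2018,
Cor 4]: a dot product is the tree whose product `aᵢbᵢ` sits in a cell `node (leaf (aᵢbᵢ)) (leaf 0)`
evaluating to `fl(aᵢbᵢ)`, the cell's hypothesis being `localErr_of_no_underflow`).
[cite: LangeRump2018, Thm 7] -/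
theorem absErr_le_height_with {c : ℚ} (hc : 0 < c) (t : SumTree)
    (hloc : AllNodes fl (fun y => |fl y - y| ≤ c * ufp p emin y) t)
    (hh : ((height t : ℚ) + 1) ^ 2 * c ≤ 1) :
    absErr fl t ≤ (height t : ℚ) * c * absSum t := by
  have := height_induction_with hc (η := height t) hh (height t) t hloc le_rfl le_rfl
  simpa using this

/-- Product cells for [LangeRump2018, Cor 4]: barring underflow (`|r| ≥ 2^(emin+p)`), a single
rounding `fl(r + 0) = fl(r)` of ANY real argument obeys the per-node hypothesis with `c = u`.
[cite: LangeRump2018, Cor 4] -/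
theorem localErr_of_no_underflow (hp : 1 ≤ p) (hfl : IsRoundNearest p emin fl) {r : ℚ}
    (hr : (2 : ℚ) ^ (emin + p) ≤ |r|) :
    |fl (r + 0) - (r + 0)| ≤ unitRoundoff p * ufp p emin (r + 0) := by
  rw [add_zero]
  unfold ufp
  rw [if_neg (not_lt.mpr hr)]
  rcases lt_or_ge r 0 with hneg | hnn
  · have h := abs_sub_fl_le_ufp_pos hp hfl.neg (t := -r) (by rwa [abs_of_neg hneg] at hr)
    simp only [neg_neg] at h
    rw [abs_of_neg hneg, abs_sub_comm, show |r - fl r| = |-r - -fl r| by rw [← abs_neg]; ring_nf]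
    exact h
  · have h := abs_sub_fl_le_ufp_pos hp hfl (t := r) (by rwa [abs_of_nonneg hnn] at hr)
    rw [abs_of_nonneg hnn, abs_sub_comm]; exact h

/-! ### Round-to-nearest: `c = u` -/

/-- Sums of floats in round-to-nearest satisfy the per-node hypothesis with `c = u`.
[cite: LangeRump2018, Prop 3 (proof)] -/
theorem allNodes_localErr_nearest (hp : 1 ≤ p) (hfl : IsRoundNearest p emin fl) :
    ∀ t : SumTree, (∀ x ∈ t.leaves, IsFloat p emin x) →
      AllNodes fl (fun y => |fl y - y| ≤ unitRoundoff p * ufp p emin y) t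
  | .leaf _, _ => trivial
  | .node l r, h => by
      have hl : ∀ x ∈ l.leaves, IsFloat p emin x := fun x hx => h x (by simp [leaves, hx])
      have hr : ∀ x ∈ r.leaves, IsFloat p emin x := fun x hx => h x (by simp [leaves, hx])
      exact ⟨allNodes_localErr_nearest hp hfl l hl, allNodes_localErr_nearest hp hfl r hr,
        abs_err_add_le_ufp hp hfl (isFloat_eval hfl l hl) (isFloat_eval hfl r hr)⟩

/-- PROPOSITION 3, nearest case, local-error form: `(h+1)²u ≤ 1` ⟹ `Σ_nodes |δ_v| ≤ h·u·Σ|aⱼ|`.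
[cite: LangeRump2018, Prop 3] -/
theorem absErr_le_height (hp : 1 ≤ p) (hfl : IsRoundNearest p emin fl) (t : SumTree)
    (hleaves : ∀ x ∈ t.leaves, IsFloat p emin x)
    (hh : ((height t : ℚ) + 1) ^ 2 * unitRoundoff p ≤ 1) :
    absErr fl t ≤ (height t : ℚ) * unitRoundoff p * absSum t :=
  absErr_le_height_with (by unfold unitRoundoff; positivity) t
    (allNodes_localErr_nearest hp hfl t hleaves) hh

/-- PROPOSITION 3 [LangeRump2018] (radix 2, round-to-nearest): for `a₁ … aₙ ∈ F` summed in some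
nearest-addition in any order whose binary tree has height `h ≤ u^{-1/2} - 1` (here:
`(h+1)²·u ≤ 1`), `|s - Σ aⱼ| ≤ h·u·Σ|aⱼ|`. Precision `p ≥ 1`, gradual underflow, any tie rule.
[cite: LangeRump2018, Prop 3] -/
theorem proposition3 (hp : 1 ≤ p) (hfl : IsRoundNearest p emin fl) (t : SumTree)
    (hleaves : ∀ x ∈ t.leaves, IsFloat p emin x)
    (hh : ((height t : ℚ) + 1) ^ 2 * unitRoundoff p ≤ 1) :
    |t.eval fl - t.exact| ≤ (height t : ℚ) * unitRoundoff p * (t.leaves.map abs).sum :=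
  le_trans (abs_eval_sub_exact_le fl t) (absErr_le_height hp hfl t hleaves hh)

/-! ### Faithful rounding: `c = 2u` -/

/-- A FAITHFUL map errs by at most one spacing `2u·2^⌊log₂ t⌋` on a positive normal-range
argument: `fl t` lies between the two neighbouring floats of `t`. Faithfulness as in
[LangeRump2018, §2]: `fl t` is the only float in the closed hull of `t` and `fl t` (stated as: every
float between `t` and `fl t` equals `fl t`). [cite: LangeRump2018, §2] -/
theorem abs_sub_fl_le_two_ufp_pos_of_faithful (hp : 1 ≤ p)
    (hfaith : ∀ s f : ℚ, IsFloat p emin f → (s ≤ f ∧ f ≤ fl s) ∨ (fl s ≤ f ∧ f ≤ s) → f = fl s)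
    {t : ℚ} (ht : (2 : ℚ) ^ (emin + p) ≤ t) :
    |t - fl t| ≤ 2 * unitRoundoff p * (2 : ℚ) ^ (Int.log 2 t) := by
  have h2 : (2 : ℚ) ≠ 0 := by norm_num
  have htpos : 0 < t := lt_of_lt_of_le (zpow_pos (by norm_num) _) ht
  set k := Int.log 2 t with hk
  have hlow : ((2 : ℕ) : ℚ) ^ k ≤ t := Int.zpow_log_le_self (by norm_num) htpos
  have hup : t < ((2 : ℕ) : ℚ) ^ (k + 1) := Int.lt_zpow_succ_log_self (by norm_num) t
  push_cast at hlow hup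
  have hk_ge : emin + p ≤ k := by
    have := log_ge_of_le (p := p) (emin := emin) (t := t) (by rwa [abs_of_pos htpos])
    rwa [abs_of_pos htpos] at this
  set c : ℚ := (2 : ℚ) ^ (k + 1 - p) with hc
  have hcpos : 0 < c := zpow_pos (by norm_num) _
  have hg : (2 : ℚ) ^ k = (2 : ℚ) ^ ((p : ℤ) - 1) * c := by
    rw [hc, ← zpow_add₀ h2]; congr 1; ring
  have hg2 : (2 : ℚ) ^ (k + 1) = (2 : ℚ) ^ (p : ℤ) * c := by
    rw [hc, ← zpow_add₀ h2]; congr 1; ring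
  set m := ⌊t / c⌋ with hm
  have hm_le : (m : ℚ) ≤ t / c := Int.floor_le _
  have hm_lt : t / c < m + 1 := Int.lt_floor_add_one _
  have hm_ge : (2 ^ (p - 1) : ℤ) ≤ m := by
    rw [hm, Int.le_floor]; push_cast
    rw [le_div_iff₀ hcpos]
    have : ((2 : ℕ) : ℚ) ^ (p - 1) * c = (2 : ℚ) ^ k := by
      rw [hg, show ((p : ℤ) - 1) = ((p - 1 : ℕ) : ℤ) by omega, zpow_natCast]; push_cast; ring
    push_cast at this; linarith
  have hm_lt' : m < (2 ^ p : ℤ) := by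
    rw [hm, Int.floor_lt]; push_cast
    rw [div_lt_iff₀ hcpos]
    have : ((2 : ℕ) : ℚ) ^ p * c = (2 : ℚ) ^ (k + 1) := by rw [hg2, zpow_natCast]; push_cast; ring
    push_cast at this; linarith
  have hm0 : (0 : ℤ) ≤ m := le_trans (by positivity) hm_ge
  have hf1 : IsFloat p emin ((m : ℚ) * c) := by
    refine ⟨m, k + 1 - p, ?_, by omega, rfl⟩
    rw [abs_of_nonneg hm0]; exact hm_lt'
  have hf2 : IsFloat p emin (((m + 1 : ℤ) : ℚ) * c) := by
    rcases lt_or_eq_of_le (Int.add_one_le_iff.mpr hm_lt') with hlt | heq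
    · refine ⟨m + 1, k + 1 - p, ?_, by omega, rfl⟩
      rw [abs_of_nonneg (by linarith)]; exact hlt
    · rw [heq]; push_cast
      have : (2 : ℚ) ^ p * c = (2 : ℚ) ^ (k + 1) := by rw [hg2, zpow_natCast]
      rw [this]
      exact isFloat_zpow hp (by omega)
  have hf1le : (m : ℚ) * c ≤ t := by rwa [le_div_iff₀ hcpos] at hm_le
  have hf2ge : t ≤ ((m + 1 : ℤ) : ℚ) * c := by
    push_cast; rw [div_lt_iff₀ hcpos] at hm_lt; linarith
  push_cast at hf2ge hf2
  -- fl t lies in [m c, (m+1) c]: otherwise a neighbour would be a second float in the hull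
  have hlo : (m : ℚ) * c ≤ fl t := by
    by_contra hlt
    have hlt' : fl t < (m : ℚ) * c := lt_of_not_ge hlt
    have := hfaith t _ hf1 (Or.inr ⟨hlt'.le, hf1le⟩)
    linarith
  have hhi : fl t ≤ ((m : ℚ) + 1) * c := by
    by_contra hlt
    have hlt' : ((m : ℚ) + 1) * c < fl t := lt_of_not_ge hlt
    have := hfaith t _ hf2 (Or.inl ⟨hf2ge, hlt'.le⟩)
    linarith
  have hu : 2 * unitRoundoff p * (2 : ℚ) ^ k = c := by
    unfold unitRoundoff
    rw [hc, show (k + 1 - (p : ℤ)) = k + 1 + (-(p : ℤ)) by ring, zpow_add₀ h2, zpow_add₀ h2,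
      zpow_neg, zpow_natCast, zpow_one]
    field_simp
  rw [hu, abs_le]
  constructor <;> linarith

/-- The mirror `s ↦ -fl(-s)` of a faithful map is faithful. [cite: LangeRump2018, §2] -/
theorem faithful_neg
    (hfaith : ∀ s f : ℚ, IsFloat p emin f → (s ≤ f ∧ f ≤ fl s) ∨ (fl s ≤ f ∧ f ≤ s) → f = fl s) :
    ∀ s f : ℚ, IsFloat p emin f →
      (s ≤ f ∧ f ≤ -fl (-s)) ∨ (-fl (-s) ≤ f ∧ f ≤ s) → f = -fl (-s) := by
  intro s f hf h
  have := hfaith (-s) (-f) hf.neg (by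
    rcases h with ⟨h1, h2⟩ | ⟨h1, h2⟩
    · exact Or.inr ⟨by linarith, by linarith⟩
    · exact Or.inl ⟨by linarith, by linarith⟩)
  linarith

/-- A FAITHFUL map into `F` errs by at most `2u·ufp` on sums of two floats (exact below
`2^(emin+p)`). [cite: LangeRump2018, §2] -/
theorem abs_err_add_le_two_ufp_of_faithful (hp : 1 ≤ p)
    (hfaith : ∀ s f : ℚ, IsFloat p emin f → (s ≤ f ∧ f ≤ fl s) ∨ (fl s ≤ f ∧ f ≤ s) → f = fl s)
    {a b : ℚ} (ha : IsFloat p emin a) (hb : IsFloat p emin b) :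
    |fl (a + b) - (a + b)| ≤ 2 * unitRoundoff p * ufp p emin (a + b) := by
  set t := a + b with ht
  unfold ufp
  split_ifs with hsmall
  · -- t ∈ F lies in the hull, hence equals fl t
    have hteq : t = fl t := hfaith t t (isFloat_add_of_small ha hb hsmall) (by
      rcases le_total t (fl t) with h | h
      · exact Or.inl ⟨le_rfl, h⟩
      · exact Or.inr ⟨h, le_rfl⟩)
    rw [← hteq, sub_self, abs_zero, mul_zero]
  · have hbig : (2 : ℚ) ^ (emin + p) ≤ |t| := not_lt.mp hsmall
    rcases lt_or_ge t 0 with hneg | hnn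
    · have h := abs_sub_fl_le_two_ufp_pos_of_faithful (fl := fun s => -fl (-s)) hp
        (faithful_neg hfaith) (t := -t) (by rwa [abs_of_neg hneg] at hbig)
      simp only [neg_neg] at h
      rw [abs_of_neg hneg, abs_sub_comm]
      rw [show |t - fl t| = |-t - -fl t| by rw [← abs_neg]; ring_nf]
      exact h
    · have h := abs_sub_fl_le_two_ufp_pos_of_faithful hp hfaith (t := t)
        (by rwa [abs_of_nonneg hnn] at hbig)
      rw [abs_of_nonneg hnn, abs_sub_comm]; exact h

/-- Sums of floats under a faithful map into `F` satisfy the per-node hypothesis with `c = 2u`.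
[cite: LangeRump2018, Prop 3 (proof)] -/
theorem allNodes_localErr_faithful (hp : 1 ≤ p) (hval : ∀ s : ℚ, IsFloat p emin (fl s))
    (hfaith : ∀ s f : ℚ, IsFloat p emin f → (s ≤ f ∧ f ≤ fl s) ∨ (fl s ≤ f ∧ f ≤ s) → f = fl s) :
    ∀ t : SumTree, (∀ x ∈ t.leaves, IsFloat p emin x) →
      AllNodes fl (fun y => |fl y - y| ≤ 2 * unitRoundoff p * ufp p emin y) t
  | .leaf _, _ => trivial
  | .node l r, h => by
      have hl : ∀ x ∈ l.leaves, IsFloat p emin x := fun x hx => h x (by simp [leaves, hx])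
      have hr : ∀ x ∈ r.leaves, IsFloat p emin x := fun x hx => h x (by simp [leaves, hx])
      exact ⟨allNodes_localErr_faithful hp hval hfaith l hl, allNodes_localErr_faithful hp hval hfaith r hr,
        abs_err_add_le_two_ufp_of_faithful hp hfaith (isFloat_eval_of hval l hl)
          (isFloat_eval_of hval r hr)⟩

/-- PROPOSITION 3, FAITHFUL CASE [LangeRump2018]: for `a₁ … aₙ ∈ F` summed in any order with ANY
faithful addition into `F` (every float between `t` and `fl t` equals `fl t`; e.g. directed
roundings, realisations of stochastic rounding) whose tree has height `h` with
`(h+1)²·(2u) ≤ 1`: `|s - Σ aⱼ| ≤ 2h·u·Σ|aⱼ|`. [cite: LangeRump2018, Prop 3] -/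
theorem proposition3_faithful (hp : 1 ≤ p) (hval : ∀ s : ℚ, IsFloat p emin (fl s))
    (hfaith : ∀ s f : ℚ, IsFloat p emin f → (s ≤ f ∧ f ≤ fl s) ∨ (fl s ≤ f ∧ f ≤ s) → f = fl s)
    (t : SumTree) (hleaves : ∀ x ∈ t.leaves, IsFloat p emin x)
    (hh : ((height t : ℚ) + 1) ^ 2 * (2 * unitRoundoff p) ≤ 1) :
    |t.eval fl - t.exact| ≤ (height t : ℚ) * (2 * unitRoundoff p) * (t.leaves.map abs).sum :=
  le_trans (abs_eval_sub_exact_le fl t)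
    (absErr_le_height_with (by unfold unitRoundoff; positivity) t
      (allNodes_localErr_faithful hp hval hfaith t hleaves) hh)

end Literature.ComputerArithmetic.LangeRump2018
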